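import Summits.QuantumFields.YangMills.Theorems.BalabanUVNodesN17AtRecord8
import Summits.QuantumFields.YangMills.Theorems.BalabanUVNodesN17AtSpineCarriers
import Literature.MathematicalPhysics.QuantumFieldTheory.Balaban1983to89.Node00.Record9

/-!
# BalabanUVNodes ∕ node N17 = NE4 AT NODE 00's STAGE-9 RECORD `Node00.IsRecordOfRecord₉C` (def-T `Node00/Record9.lean` p420804): the datum
# `datumOfRecord₉ F N θ h` carries the Stage-8 β of record (`βfun_datumOfRecord₉`, `rfl`), so every N17 face of companions 4–7 holds there BY NAME;
# Stage-9 admissibility CARRIES the chart clause of record (chair R448), so the ∀-forms over ₉C are charted by construction; the K4 link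

Cell `pub-ymgap`, HUMAN RULING D-0062, seat `pub-ymgap-dag-n17-a` (-a KNIT-BY-NAME), generation 5; companion 8 (§28–§30) of `BalabanUVNodesN17Knit` …
`BalabanUVNodesN17AtSpineCarriers` (p421092) ∕ `…AtRecord8X`.  THEOREMS ONLY; imports companion 5 `…N17AtRecord8` (p417546: `N17_datumOfRecord₈_iff_merged`,
`u2Inputs_datumOfRecord₈_iff`, companion 4's `scaleShiftRate_betaMerged_of_kernelStepRate`), companion 6 `…N17AtSpineCarriers` (module 2's `N17At`, `S_N17`,
`U3Carriers`, `RateCarriers`, `RateRecordPred` by name) and def-T's `Node00/Record9` (`Stage9Params`, `Stage9Params.Admissible` with `.toStage8 ∕ .chart`,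
`Stage9Params.Provisos`, `betaOfRecord₉`, `datumOfRecord₉`, `βfun_datumOfRecord₉`, `IsRecordOfRecord₉C`, `exists_isRecordOfRecord₅C_of_isRecordOfRecord₉C`);
modifies nothing; every cited lemma is used BY NAME.

THE POINT.  `IsRecordOfRecord₉C F N D w := ∃ (θ : Stage9Params F N) (h : θ.Provisos), θ.Admissible ∧ D = datumOfRecord₉ F N θ h ∧ w.C = D.C ∧ (0 < w.γ ∧ w.γ ≤ θ.γ)
∧ …` (Record9 :503); the Stage-9 datum is a TOWER datum (densities = the represented tower of record) whose β-functions ARE Stage 8's: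
`(datumOfRecord₉ F N θ h).βfun = betaOfRecord₉ F N θ = betaOfRecord₈ F N θ.toStage8Params` (`βfun_datumOfRecord₉`, `rfl`).  Node N17 reads the datum ONLY
through `βfun` (companion 6 `n17At_congr_βfun`), so the tower ∕ Radon–Nikodym-version caveat of def-T's ₅C refinement («NOT at `D` itself») does NOT touch the
N17 row: every N17 face transfers to ₉C by `rfl` on `βfun`.  And `Stage9Params.Admissible` := Stage-8 admissibility ∧ `0 < cβ` ∧ `IsChartOfRecord cβ` ∧ `1 ≤ τ9.M`
— THE ₈X CHART CLAUSE VERBATIM — so every ∀-form below is asked of CHARTED witnesses only (R448 (1) at ₉).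
* §28 AT THE STAGE-9 DATUM: `βfun_datumOfRecord₉_eq_stage8` (the Stage-9 datum and the Stage-8 datum of `θ.toStage8Params` have THE SAME `βfun`),
  `N17_datumOfRecord₉_iff_stage8`, **`N17_datumOfRecord₉_iff_merged`** (box `γ' ≤ θ.γ`: N17 at the Stage-9 datum ↔ the η-rate of def-B's merged β of the Stage-8
  view), `u2Inputs_datumOfRecord₉_iff`, `n17At_datumOfRecord₉_iff_merged` (cluster K4's letters).
* §29 AT THE RECORD PREDICATE ₉C: **`N17_of_isRecordOfRecord₉C`** (the merged-β rate on the world's window asked of every admissible Stage-9 θ WITH ITS PROVISOS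
  realising `D`), `N17_of_isRecordOfRecord₉C_kernelStepRate` ((UD) + history-matched step rate of the record's own `Node00.polLimit` kernels — the content form),
  `u2Inputs_of_isRecordOfRecord₉C` (node U2's triple, the N17 → N27 edge's input), **`exists_chart_scaleShiftRate_of_N17₉`** (`2 ≤ N`: N17 at a ₉C record IS an
  η-rate of the merged β through a chart with `ρ8 ≠ 0` — `Admissible.chart` + `IsChartOfRecord.rho8_ne_zero`; no zero-chart reading), `exists_shadow₅_N17_iff`
  (every ₉C record has def-T's ₅C shadow with the same `βfun`, at which N17 — and every β-reading face — is THE SAME statement).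
* §30 THE K4 LINK: **`s_N17_of_stage9_slot`** (`S_N17 RRec` for EVERY rate-record predicate whose bundles come with an admissible Stage-9 witness-with-provisos
  realising the datum, `R.u3.γ ≤ θ.γ`, and the merged-β rate at `R.u3`'s dependent letters — the one-application closer for an `RRec` home typed over ₉C);
  `readOutAt_datumOfRecord₉_iff_stage8` (the U3 road at Stage 9: module 2's (D4) binders `ReadOutAt` at the Stage-9 datum = at the Stage-8 datum, so companion 6's
  stage-free glue `YMDAG.N17.s_N17_of_D4_N18` applies verbatim).
NO INHABITANT of `IsRecordOfRecord₉C` is claimed anywhere (def-T: «inhabitation of the record class is EXACTLY some admissible θ satisfying the displayed provisos»);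
accordingly nothing here is inhabited-at-₉C, and nothing needs a junk guard.
β-VERSION (RIDER OF RECORD №6, director-ym LINE №44 (b); def-T ERRATUM pub-ymgap INBOX l.10987; dag-lead DEDUP №25): the β read here is
`betaOfRecord₉ = betaOfRecord₈ ∘ toStage8Params` — a pointwise second derivative of the log of a density transported by a KERNEL-FORM transport whose marginal
density and disintegration kernel are `rnDeriv`∕`condKernel` REPRESENTATIVES («kernel form ✓, pointwise determinacy ✗ at ₉»); hence NO β-side binder is booked at
Stage 9 over this β, and a discharge read over it would be GAP-STATED(version) by ref-D.  The version repair is def-T's INTENT-4 (`Node00/ContinuousTransportOfRecord`,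
a pointwise-determined `betaOfRecord₉c`) ∕ a later `Record10`; every statement below is count-neutral bookkeeping that reads the datum ONLY through `βfun` and
therefore transfers verbatim to the repaired β by `βfun`-congruence (companion 6 `YMDAG.N17.n17At_congr_βfun`, §29 `exists_shadow₅_N17_iff`'s pattern).

HONEST FRAMING.  Kernel bookkeeping BY NAME; 0 sorry; NE4 NOT IN PRINT ([Balaban1987RG1] (1.20)–(1.22) p. 264) and NOT PROVED; every rate input a displayed
HYPOTHESIS (rows NE2∕NE3∕NE5 through (1.22); (UD) = (5.10) p. 293 printed for Bałaban's kernels, a hypothesis here); the Stage-9 provisos are def-T's existential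
clause, never assumed here except as the record predicate's own conjunct; nothing of Bałaban's asserted; N17 NOT discharged; «A: n∕28» unmoved.  One finite
four-torus at fixed ε per run — NOT infinite volume, NOT OS on ℝ⁴, NOT a mass gap, NOT Clay.
-/

noncomputable section

open scoped Matrix.Norms.L2Operator

namespace Summit.QuantumFields.YangMills.Theorems.BalabanUVNodesN17

open Filter Topology
open Literature.MathematicalPhysics.QuantumFieldTheory.Balaban1983to89
open Literature.MathematicalPhysics.QuantumFieldTheory.Balaban1983to89.FlowStep
open Literature.MathematicalPhysics.QuantumFieldTheory.Balaban1983to89.T4CouplingMatching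
open Literature.MathematicalPhysics.QuantumFieldTheory.Balaban1983to89.T4Continuum (T4Family FiniteEpsData ULoop)
open Literature.MathematicalPhysics.QuantumFieldTheory.Balaban1983to89.B12Sec2to5 (Decay510 betaPrime510)
open Literature.MathematicalPhysics.QuantumFieldTheory.Balaban1983to89.Beta.LimitRate (subKernel)
open Literature.MathematicalPhysics.QuantumFieldTheory.Balaban1983to89.Node00
open Literature.MathematicalPhysics.QuantumFieldTheory.Balaban1983to89.DagBinding (WorldP)
open Summit.QuantumFields.BalabanUV.T4Continuum.Spine.NE4 (NE4OnData U2Inputs ne4OnData_iff)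
open YMDAG.UVSplit (Datum U3Carriers RateCarriers RateRecordPred N17At S_N17)

variable {F : T4Family} {N : ℕ} [NeZero N]

/-! ## §28 N17 AT THE STAGE-9 DATUM `datumOfRecord₉ F N θ h` — the same `βfun` as the Stage-8 datum of `θ.toStage8Params` -/

/-- **THE STAGE-9 DATUM AND THE STAGE-8 DATUM OF ITS STAGE-8 VIEW HAVE THE SAME β-FUNCTIONS** [bookkeeping] (`βfun_datumOfRecord₉` and `βfun_stage8`, both `rfl`):
the tower datum re-keys densities and `𝐓ρ`, not β. [cite: Balaban1987RG1, (1.20)-(1.22) p.264] -/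
theorem βfun_datumOfRecord₉_eq_stage8 (θ : Stage9Params F N) (h : θ.Provisos) :
    (datumOfRecord₉ F N θ h).βfun = (datumOfRecord₅ F N (θ.toStage8Params.toStage5 F N)).βfun := by
  rw [βfun_datumOfRecord₉, βfun_stage8]

/-- **N17 AT THE STAGE-9 DATUM IS N17 AT THE STAGE-8 DATUM** [bookkeeping] — on every box, with every constant and rate (N17 reads `βfun` only).
[cite: Balaban1987RG1, (1.20)-(1.22) p.264] -/
theorem N17_datumOfRecord₉_iff_stage8 (θ : Stage9Params F N) (h : θ.Provisos) (c ρ γ' : ℝ) :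
    NE4OnData (datumOfRecord₉ F N θ h) c ρ γ' ↔ NE4OnData (datumOfRecord₅ F N (θ.toStage8Params.toStage5 F N)) c ρ γ' := by
  rw [ne4OnData_iff, ne4OnData_iff, βfun_datumOfRecord₉_eq_stage8]

/-- **N17 AT THE STAGE-9 DATUM READS THE MERGED β OF THE STAGE-8 VIEW** on every box side `γ' ≤ θ.γ`:
`NE4OnData (datumOfRecord₉ F N θ h) c ρ γ' ↔ ScaleShiftRate c ρ γ' (betaMerged F (mergedTermFamilyMat F N (chi7 F N θ₈) θ.εbg) θ.ρ8 θ.bV)`, `θ₈ = θ.toStage8Params`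
(companion 5 `N17_datumOfRecord₈_iff_merged` through §28's `βfun` identity). [cite: Balaban1987RG1, (1.20)-(1.22) p.264] -/
theorem N17_datumOfRecord₉_iff_merged (θ : Stage9Params F N) (h : θ.Provisos) {c ρ γ' : ℝ} (hγ : γ' ≤ θ.γ) :
    NE4OnData (datumOfRecord₉ F N θ h) c ρ γ' ↔
      letI := θ.instVβ₁; letI := θ.instVβ₂; letI := θ.instιβ
      ScaleShiftRate c ρ γ'
        (betaMerged F (mergedTermFamilyMat F N (chi7 F N θ.toStage8Params) θ.εbg) θ.ρ8 θ.bV) :=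
  (N17_datumOfRecord₉_iff_stage8 θ h c ρ γ').trans (N17_datumOfRecord₈_iff_merged θ.toStage8Params hγ)

/-- **NODE U2's INPUT TRIPLE AT THE STAGE-9 DATUM** (box `γ' ≤ θ.γ`): `U2Inputs D₉ c C ρ γ' Λ ↔` the merged-β rate ∧ its history moduli ∧ the β-free fading-memory
clause (companion 5 `u2Inputs_datumOfRecord₈_iff` through the `βfun` identity). [cite: Balaban1987RG1, §5 p.298] -/
theorem u2Inputs_datumOfRecord₉_iff (θ : Stage9Params F N) (h : θ.Provisos) {c C ρ γ' : ℝ} {Λ : ℕ → ℕ → ℝ} (hγ : γ' ≤ θ.γ) :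
    U2Inputs (datumOfRecord₉ F N θ h) c C ρ γ' Λ ↔
      letI := θ.instVβ₁; letI := θ.instVβ₂; letI := θ.instιβ
      ScaleShiftRate c ρ γ' (betaMerged F (mergedTermFamilyMat F N (chi7 F N θ.toStage8Params) θ.εbg) θ.ρ8 θ.bV) ∧
        HistLipschitz Λ γ' (betaMerged F (mergedTermFamilyMat F N (chi7 F N θ.toStage8Params) θ.εbg) θ.ρ8 θ.bV) ∧
        FadingMemory C ρ Λ := by
  have hβ := βfun_datumOfRecord₉_eq_stage8 θ h
  rw [← u2Inputs_datumOfRecord₈_iff θ.toStage8Params hγ]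
  unfold U2Inputs
  rw [hβ]

/-- **… IN CLUSTER K4's LETTERS** [bookkeeping]: for node U3's carriers `u` with `u.γ ≤ θ.γ`, `N17At (datumOfRecord₉ F N θ h) u ↔` the merged-β rate at the dependent
letters `(u.cr·u.C₅·u.θ, u.ρ, u.γ)` (module 2's `N17At` = `NE4OnData` at those letters). [cite: Balaban1987RG1, (1.20)-(1.22) p.264] -/
theorem n17At_datumOfRecord₉_iff_merged (θ : Stage9Params F N) (h : θ.Provisos) (u : U3Carriers) (hγ : u.γ ≤ θ.γ) :
    N17At (datumOfRecord₉ F N θ h) u ↔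
      letI := θ.instVβ₁; letI := θ.instVβ₂; letI := θ.instιβ
      ScaleShiftRate (u.cr * u.C₅ * u.θ) u.ρ u.γ
        (betaMerged F (mergedTermFamilyMat F N (chi7 F N θ.toStage8Params) θ.εbg) θ.ρ8 θ.bV) :=
  N17_datumOfRecord₉_iff_merged θ h hγ

/-! ## §29 N17 AT THE RECORD PREDICATE `IsRecordOfRecord₉C F N D w` — ∀-forms over admissible θ WITH PROVISOS (charted by construction) -/

/-- **N17 AT A STAGE-9 RECORD `(D, w)`.**  If at EVERY admissible Stage-9 parameter with its provisos whose datum is `D` and whose record box contains the world's window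
the merged β of its Stage-8 view satisfies `ScaleShiftRate cN ρ w.γ`, then `NE4OnData D cN ρ w.γ` — the chart clause (`Admissible.chart`), the box side `w.γ ≤ θ.γ`
and its positivity being CLAUSES of `IsRecordOfRecord₉C`.  Hypothesis displayed, not asserted. [cite: Balaban1987RG1, (1.20)-(1.22) p.264; Balaban1989LargeFieldII, Thm 1 p.355] -/
theorem N17_of_isRecordOfRecord₉C {D : Datum F N} {w : WorldP} (h : IsRecordOfRecord₉C F N D w) {cN ρ : ℝ}
    (hin : ∀ (θ : Stage9Params F N) (hP : θ.Provisos), θ.Admissible → D = datumOfRecord₉ F N θ hP → w.γ ≤ θ.γ →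
      letI := θ.instVβ₁; letI := θ.instVβ₂; letI := θ.instιβ
      ScaleShiftRate cN ρ w.γ (betaMerged F (mergedTermFamilyMat F N (chi7 F N θ.toStage8Params) θ.εbg) θ.ρ8 θ.bV)) :
    NE4OnData D cN ρ w.γ := by
  obtain ⟨θ, hP, hθ, hD, -, ⟨-, hγle⟩, -, -⟩ := h
  have hm := hin θ hP hθ hD hγle
  subst hD
  exact (N17_datumOfRecord₉_iff_merged θ hP hγle).mpr hm

/-- **N17 AT A STAGE-9 RECORD IN KERNEL CURRENCY — the content form.**  (UD) ((5.10)-decay, some `C`, `δ > 0` per witness) ∧ the HISTORY-MATCHED STEP RATE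
`|Π_{k+2}(w; x) − Π_{k+1}(tail w; x)| ≤ C′ρ^k e^{−δ′|x|₁}` (fixed `C′`, `δ′ > 0`) of the record's OWN limiting polarisation kernels `Node00.polLimit` of the Stage-8 view's
merged term family, read through the (charted) `(θ.ρ8, θ.bV)`, on the world's window, asked of every admissible Stage-9 witness with provisos ⟹
`NE4OnData D (β′(C′,δ′)) ρ w.γ` (companion 4 `scaleShiftRate_betaMerged_of_kernelStepRate`).  (UD) PRINTED for Bałaban's kernels, the step rate NOT (rows
NE2∕NE3∕NE5 = N15∕N16∕N18 in the record's letters). [cite: Balaban1987RG1, (1.21)-(1.22) p.264 and (5.10) p.293] -/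
theorem N17_of_isRecordOfRecord₉C_kernelStepRate {D : Datum F N} {w : WorldP} (h : IsRecordOfRecord₉C F N D w) {C' δ' ρ : ℝ}
    (hδ' : 0 < δ')
    (hin : ∀ (θ : Stage9Params F N) (hP : θ.Provisos), θ.Admissible → D = datumOfRecord₉ F N θ hP → w.γ ≤ θ.γ →
      letI := θ.instVβ₁; letI := θ.instVβ₂; letI := θ.instιβ
      (∃ C δ : ℝ, 0 < δ ∧ ∀ k (v : Fin (k + 1) → ℝ), v ∈ Box w.γ k →
        Decay510 (polLimit F (k + 1) (fun K => mergedTermFamilyMat F N (chi7 F N θ.toStage8Params) θ.εbg k v K) θ.ρ8 θ.bV 0 1) C δ) ∧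
      (∀ k (u : Fin (k + 2) → ℝ), u ∈ Box w.γ (k + 1) →
        Decay510 (subKernel
          (polLimit F (k + 1 + 1) (fun K => mergedTermFamilyMat F N (chi7 F N θ.toStage8Params) θ.εbg (k + 1) u K) θ.ρ8 θ.bV)
          (polLimit F (k + 1) (fun K => mergedTermFamilyMat F N (chi7 F N θ.toStage8Params) θ.εbg k (Fin.tail u) K) θ.ρ8 θ.bV) 0 1)
          (C' * ρ ^ k) δ')) :
    NE4OnData D (betaPrime510 4 C' δ') ρ w.γ := by
  obtain ⟨θ, hP, hθ, hD, -, ⟨-, hγle⟩, -, -⟩ := h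
  obtain ⟨⟨C, δ, hδ, hU⟩, hS⟩ := hin θ hP hθ hD hγle
  subst hD
  letI := θ.instVβ₁; letI := θ.instVβ₂; letI := θ.instιβ
  exact (N17_datumOfRecord₉_iff_merged θ hP hγle).mpr
    (scaleShiftRate_betaMerged_of_kernelStepRate F (mergedTermFamilyMat F N (chi7 F N θ.toStage8Params) θ.εbg) θ.ρ8 θ.bV
      hδ hδ' hU hS)

/-- **NODE U2's INPUT TRIPLE AT A STAGE-9 RECORD** (the N17 → N27 edge's input): N17 ∧ the history moduli OF THE MERGED β on the world's window, asked of every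
admissible witness with provisos, ∧ the β-free fading-memory clause ⟹ `U2Inputs D cN C ρ w.γ Λ`. [cite: Balaban1987RG1, §5 p.298] -/
theorem u2Inputs_of_isRecordOfRecord₉C {D : Datum F N} {w : WorldP} (h : IsRecordOfRecord₉C F N D w) {cN C ρ : ℝ}
    {Λ : ℕ → ℕ → ℝ} (hF : FadingMemory C ρ Λ)
    (hin : ∀ (θ : Stage9Params F N) (hP : θ.Provisos), θ.Admissible → D = datumOfRecord₉ F N θ hP → w.γ ≤ θ.γ →
      letI := θ.instVβ₁; letI := θ.instVβ₂; letI := θ.instιβ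
      ScaleShiftRate cN ρ w.γ (betaMerged F (mergedTermFamilyMat F N (chi7 F N θ.toStage8Params) θ.εbg) θ.ρ8 θ.bV) ∧
        HistLipschitz Λ w.γ (betaMerged F (mergedTermFamilyMat F N (chi7 F N θ.toStage8Params) θ.εbg) θ.ρ8 θ.bV)) :
    U2Inputs D cN C ρ w.γ Λ := by
  obtain ⟨θ, hP, hθ, hD, -, ⟨-, hγle⟩, -, -⟩ := h
  obtain ⟨hm, hL⟩ := hin θ hP hθ hD hγle
  subst hD
  exact (u2Inputs_datumOfRecord₉_iff θ hP hγle).mpr ⟨hm, hL, hF⟩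

/-- **`2 ≤ N`: N17 AT A ₉C RECORD IS AN η-RATE STATEMENT ABOUT THE MERGED β THROUGH A GENUINE CHART** (kernel): from `IsRecordOfRecord₉C F N D w` and
`NE4OnData D c ρ w.γ` one obtains an admissible Stage-9 witness θ with provisos, `θ.ρ8 ≠ 0` (`Admissible.chart` + `IsChartOfRecord.rho8_ne_zero`), `w.γ ≤ θ.γ`,
`D` its datum, AND the rate `ScaleShiftRate c ρ w.γ` of the merged β of its Stage-8 view — no zero-chart reading exists at Stage 9 (the chart clause is IN
admissibility, R448 (1)). [cite: Balaban1987RG1, (1.20)-(1.22) p.264] -/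
theorem exists_chart_scaleShiftRate_of_N17₉ {D : Datum F N} {w : WorldP} (h : IsRecordOfRecord₉C F N D w) (hN : 2 ≤ N) {c ρ : ℝ}
    (hN17 : NE4OnData D c ρ w.γ) :
    ∃ (θ : Stage9Params F N) (hP : θ.Provisos), θ.Admissible ∧ (letI := θ.instVβ₁; letI := θ.instVβ₂; θ.ρ8) ≠ 0 ∧ w.γ ≤ θ.γ ∧
      D = datumOfRecord₉ F N θ hP ∧
      letI := θ.instVβ₁; letI := θ.instVβ₂; letI := θ.instιβ
      ScaleShiftRate c ρ w.γ (betaMerged F (mergedTermFamilyMat F N (chi7 F N θ.toStage8Params) θ.εbg) θ.ρ8 θ.bV) := by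
  obtain ⟨θ, hP, hθ, hD, -, ⟨-, hγle⟩, -, -⟩ := h
  refine ⟨θ, hP, hθ, hθ.chart.2.rho8_ne_zero hθ.chart.1 hN, hγle, hD, ?_⟩
  subst hD
  exact (N17_datumOfRecord₉_iff_merged θ hP hγle).mp hN17

/-- **EVERY ₉C RECORD HAS def-T's STAGE-5 SHADOW WITH THE SAME β-FUNCTIONS, AT WHICH N17 IS THE SAME STATEMENT** [bookkeeping]
(`Record9.exists_isRecordOfRecord₅C_of_isRecordOfRecord₉C`): so every β-reading face of the N17 row proved over a Stage-≤ 8 record shape transfers to Stage 9 —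
the tower-datum ∕ Radon–Nikodym-version caveat of the ₅C refinement concerns `Tρ`, not `βfun`. [cite: Balaban1989LargeFieldII, Thm 1 p.355 (bookkeeping)] -/
theorem exists_shadow₅_N17_iff {D : Datum F N} {w : WorldP} (h : IsRecordOfRecord₉C F N D w) :
    ∃ D₅ : Datum F N, IsRecordOfRecord₅C F N D₅ w ∧ D₅.βfun = D.βfun ∧
      ∀ (c ρ γ' : ℝ), NE4OnData D c ρ γ' ↔ NE4OnData D₅ c ρ γ' := by
  obtain ⟨D₅, h5, -, -, hβ, -⟩ := exists_isRecordOfRecord₅C_of_isRecordOfRecord₉C h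
  exact ⟨D₅, h5, hβ, fun c ρ γ' => by rw [ne4OnData_iff, ne4OnData_iff, hβ]⟩

/-! ## §30 THE LINK TO CLUSTER K4's STUB `YMDAG.UVSplit.S_N17 RRec` AT STAGE 9 -/

/-- **(W2) CLOSER — `S_N17 RRec` FOR EVERY RATE RECORD READING THE STAGE-9 RECORD WITH THE RATE** (kernel): if every bundle `R` of record for `(F, D, g₀, os)` comes
with an admissible Stage-9 witness θ WITH ITS PROVISOS realising `D`, with `R.u3.γ ≤ θ.γ`, at which the merged β of θ's Stage-8 view has the η-rate at `R.u3`'s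
dependent letters, then `S_N17 RRec` — the one-application closer for an `RRec` home typed over `IsRecordOfRecord₉C` (admissibility displayed, not used by the
implication; it carries the chart clause, so the slot is R448-countable). [cite: Balaban1987RG1, (1.20)-(1.22) p.264] -/
theorem s_N17_of_stage9_slot (RRec : RateRecordPred N)
    (hslot : ∀ (F : T4Family) (D : Datum F N) (g₀ : ℕ → ℝ) (os : List (ULoop F)) (R : RateCarriers N), RRec F D g₀ os R →
      ∃ (θ : Stage9Params F N) (hP : θ.Provisos), θ.Admissible ∧ D = datumOfRecord₉ F N θ hP ∧ R.u3.γ ≤ θ.γ ∧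
        letI := θ.instVβ₁; letI := θ.instVβ₂; letI := θ.instιβ
        ScaleShiftRate (R.u3.cr * R.u3.C₅ * R.u3.θ) R.u3.ρ R.u3.γ
          (betaMerged F (mergedTermFamilyMat F N (chi7 F N θ.toStage8Params) θ.εbg) θ.ρ8 θ.bV)) :
    S_N17 RRec := by
  intro F D g₀ os R hR
  obtain ⟨θ, hP, -, hD, hγ, hm⟩ := hslot F D g₀ os R hR
  subst hD
  exact (n17At_datumOfRecord₉_iff_merged θ hP R.u3 hγ).mpr hm

/-- **THE (D4) READ-OUT BINDERS AT A STAGE-9 DATUM ARE STATEMENTS ABOUT THE STAGE-8 β OF RECORD** [bookkeeping]: by the U3 road (companion 6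
`YMDAG.N17.s_N17_of_D4_N18`, stage-free) an `RRec` home over ₉C closes `S_N17` from `S_D4 ∧ S_N18`; there `ReadOutAt (datumOfRecord₉ F N θ h) u` asks the two
runs' output functionals to REPRESENT `betaOfRecord₈ F N θ.toStage8Params` on the `u.γ`-boxes — the same clause as at the Stage-8 datum (`βfun` identity of §28).
[cite: Balaban1987RG1, (1.20)-(1.22) p.264] -/
theorem readOutAt_datumOfRecord₉_iff_stage8 (θ : Stage9Params F N) (h : θ.Provisos) (u : U3Carriers) :
    YMDAG.UVSplit.ReadOutAt (datumOfRecord₉ F N θ h) u ↔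
      YMDAG.UVSplit.ReadOutAt (datumOfRecord₅ F N (θ.toStage8Params.toStage5 F N)) u := by
  unfold YMDAG.UVSplit.ReadOutAt
  rw [βfun_datumOfRecord₉_eq_stage8]

end Summit.QuantumFields.YangMills.Theorems.BalabanUVNodesN17

end
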